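import Literature.MathematicalPhysics.QuantumLattice.GrassmannCollapse
import Literature.MathematicalPhysics.QuantumLattice.GrassmannLaplacianTruncatedBound
import Literature.MathematicalPhysics.QuantumLattice.GrassmannRelabelling
import HarnessLib

/-!
# The `L¹–L^∞` bound for the kernels of the truncated expectations `𝓔ᵀ_C(V; n)` of one even element

Topic `Literature/MathematicalPhysics/QuantumLattice`; the single-scale estimate of the fermionic
renormalisation group in the form in which it is USED (Benfatto–Giuliani–Mastropietro 2006, (2.13)–(2.14)
with (2.77)–(2.80); Gawȩdzki–Kupiainen 1985): for an even element `V = Σ_{m'} Σ_Y K_{m'}(Y) ψ(Y)`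
(degrees `2m'`) with anchored `L¹` norms `≤ N_{m'}`, the kernels of its `n`-th truncated expectation
`𝓔ᵀ_C(V; n) = cumulantOf (k ↦ e^{Δ_C}(V^k)) n` obey, one output label pinned and the others summed,
a bound `n · Σ_{degree assignments δ} (r!)⁻¹ N_δ^{(r)} κ^{N_δ-r-2(n-1)} (∏_a N_{δ_a}) λ^{-(n-1)} ∏_ℓ (1 + 4λα δ δ'_ℓ)`
— no `n!`.  Assembly of: replicas and collapse (`GrassmannCollapse`), multilinearity in the degrees (here,
from the tree formula), the bound for kernel vertices (`GrassmannLaplacianTruncatedBound`), and the kernels of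
a collapsed element (`kernel_collapse`).

* `iterDeriv_collapse`, `constPart_collapse`, **`kernel_collapse`** (`kernel (collapse φ F) m X = Σ_{φ∘X' = X} kernel F m X'`),
  `sum_filter_norm_kernel_collapse_le`;
* `ursellOf_convMoment_eq_sum_piFinset` — multilinearity of the truncated expectation in the vertices;
* `vertexOf`, `replicaVertex`, `collapseEven_replicaVertex`;
* `patSet_eq_empty_of_card_lt`, `kernel_ursellOf_kernelVertex_eq_zero_of_lt` — with fewer than `r + 2(n-1)` fields
  the `r`-kernels vanish;
* **`sum_norm_kernel_cumulantOf_le`** — the bound.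

Everything is proved; no named fact.

## Sources

G. Benfatto, A. Giuliani, V. Mastropietro, Ann. Henri Poincaré 7 (2006) 809–898, (2.13)–(2.14), (2.66)–(2.80)
(`BenfattoGiulianiMastropietro2006`); K. Gawȩdzki, A. Kupiainen, Comm. Math. Phys. 102 (1985) 1–30
(`GawedzkiKupiainen1985GrossNeveu`).
-/

noncomputable section

namespace Literature.MathematicalPhysics.QuantumLattice

open GrassmannAlgebra Finset Literature.Probability.LatticeModels Literature.Probability.LatticeModels.BattleFederbush
open scoped InnerProductSpace

/-! ### The kernels of a collapsed element -/

section KernelCollapse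

variable (R : Type*) [CommRing R] [Algebra ℚ R] {Γ Γ' : Type*} [Fintype Γ'] [DecidableEq Γ] (φ : Γ' → Γ)

omit [Algebra ℚ R] in
/-- **Iterated derivatives of a collapsed element**: `∂_X (collapse a) = collapse (Σ_{φ∘X' = X} ∂_{X'} a)`. [folklore] -/
theorem iterDeriv_collapse : ∀ {m : ℕ} (X : Fin m → Γ) (a : GrassmannAlgebra R Γ'),
    iterDeriv R X (collapse R φ a) = collapse R φ (∑ X' ∈ univ.filter (fun X' : Fin m → Γ' => ∀ i, φ (X' i) = X i), iterDeriv R X' a)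
  | 0, X, a => by
    rw [iterDeriv_zero_apply, filter_true_of_mem fun X' _ i => i.elim0, Fintype.sum_eq_single (fun i => i.elim0 : Fin 0 → Γ')
      fun X' hX' => absurd (funext fun i => i.elim0) hX', iterDeriv_zero_apply]
  | m + 1, X, a => by
    rw [iterDeriv_succ_apply, grassmannDeriv_collapse, iterDeriv_collapse (fun i => X i.succ)]
    congr 1
    simp only [map_sum]
    have hL : ∑ X'' ∈ univ.filter (fun X'' : Fin m → Γ' => ∀ i, φ (X'' i) = X i.succ),
        ∑ Y ∈ univ.filter (fun Y => φ Y = X 0), iterDeriv R X'' (grassmannDeriv R Y a) =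
        ∑ Y : Γ', ∑ X'' : Fin m → Γ', if φ Y = X 0 ∧ ∀ i, φ (X'' i) = X i.succ then iterDeriv R X'' (grassmannDeriv R Y a) else 0 := by
      rw [sum_comm, sum_filter]
      refine sum_congr rfl fun Y _ => ?_
      by_cases hY : φ Y = X 0
      · rw [if_pos hY, sum_filter]
        exact sum_congr rfl fun X'' _ => by simp only [hY, true_and]
      · rw [if_neg hY]
        exact (sum_eq_zero fun X'' _ => by rw [if_neg (fun h => hY h.1)]).symm
    have hR : ∑ X' ∈ univ.filter (fun X' : Fin (m + 1) → Γ' => ∀ i, φ (X' i) = X i), iterDeriv R X' a =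
        ∑ Y : Γ', ∑ X'' : Fin m → Γ', if φ Y = X 0 ∧ ∀ i, φ (X'' i) = X i.succ then iterDeriv R X'' (grassmannDeriv R Y a) else 0 := by
      rw [sum_filter, ← Equiv.sum_comp (Fin.consEquiv fun _ : Fin (m + 1) => Γ')
        (fun X' : Fin (m + 1) → Γ' => if ∀ i, φ (X' i) = X i then iterDeriv R X' a else 0), Fintype.sum_prod_type]
      refine sum_congr rfl fun Y _ => sum_congr rfl fun X'' _ => ?_
      simp only [Fin.consEquiv_apply, Fin.forall_fin_succ, Fin.cons_zero, Fin.cons_succ]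
      split_ifs
      · rw [iterDeriv_succ_apply]
        rfl
      · rfl
    rw [hL, hR]

omit [Algebra ℚ R] [Fintype Γ'] [DecidableEq Γ] in
/-- Collapsing does not change the constant part. [folklore] -/
theorem constPart_collapse [Fintype Γ'] [DecidableEq Γ] (a : GrassmannAlgebra R Γ') : constPart R (collapse R φ a) = constPart R a := by
  have h : (constPart R (Γ := Γ)).comp (collapse R φ) = constPart R :=
    ExteriorAlgebra.hom_ext (LinearMap.ext fun v => by simp [collapse_ι])
  exact AlgHom.congr_fun h a

/-- **The kernels of a collapsed element**: `kernel (collapse φ F) m X = Σ_{φ ∘ X' = X} kernel F m X'`. [folklore] -/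
theorem kernel_collapse {m : ℕ} (F : GrassmannAlgebra R Γ') (X : Fin m → Γ) :
    kernel R (collapse R φ F) m X = ∑ X' ∈ univ.filter (fun X' : Fin m → Γ' => ∀ i, φ (X' i) = X i), kernel R F m X' := by
  rw [kernel_def, iterDeriv_collapse, constPart_collapse, map_sum, mul_sum]
  rfl

end KernelCollapse

section KernelCollapseNorm

variable {𝕜 : Type*} [RCLike 𝕜] {Γ : Type*} [Fintype Γ] [DecidableEq Γ] {n : ℕ}

/-- **The pinned sums of the kernels of a collapsed element**:
`Σ_{X : X_i = w} ‖kernel (collapse snd F) m X‖ ≤ Σ_b Σ_{X' : X'_i = (b, w)} ‖kernel F m X'‖`. [folklore] -/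
theorem sum_filter_norm_kernel_collapse_le (F : GrassmannAlgebra 𝕜 (Fin n × Γ)) {m : ℕ} (i : Fin m) (w : Γ) :
    ∑ X ∈ univ.filter (fun X : Fin m → Γ => X i = w), ‖kernel 𝕜 (collapse 𝕜 (Prod.snd : Fin n × Γ → Γ) F) m X‖ ≤
      ∑ b : Fin n, ∑ X' ∈ univ.filter (fun X' : Fin m → Fin n × Γ => X' i = (b, w)), ‖kernel 𝕜 F m X'‖ := by
  calc ∑ X ∈ univ.filter (fun X : Fin m → Γ => X i = w), ‖kernel 𝕜 (collapse 𝕜 (Prod.snd : Fin n × Γ → Γ) F) m X‖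
      ≤ ∑ X ∈ univ.filter (fun X : Fin m → Γ => X i = w),
          ∑ X' ∈ univ.filter (fun X' : Fin m → Fin n × Γ => ∀ j, (X' j).2 = X j), ‖kernel 𝕜 F m X'‖ := by
        refine sum_le_sum fun X _ => ?_
        rw [kernel_collapse]
        exact norm_sum_le _ _
    _ = ∑ X ∈ univ.filter (fun X : Fin m → Γ => X i = w),
          ∑ X' ∈ (univ.filter fun X' : Fin m → Fin n × Γ => (X' i).2 = w).filter (fun X' => (fun j => (X' j).2) = X), ‖kernel 𝕜 F m X'‖ := by
        refine sum_congr rfl fun X hX => sum_congr ?_ fun _ _ => rfl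
        ext X'
        simp only [mem_filter, mem_univ, true_and, funext_iff]
        constructor
        · intro h
          exact ⟨by rw [h i]; exact (mem_filter.1 hX).2, h⟩
        · exact fun h => h.2
    _ = ∑ X' ∈ univ.filter (fun X' : Fin m → Fin n × Γ => (X' i).2 = w), ‖kernel 𝕜 F m X'‖ := by
        refine sum_fiberwise_of_maps_to (fun X' hX' => ?_) _
        rw [mem_filter] at hX' ⊢
        exact ⟨mem_univ _, hX'.2⟩
    _ = ∑ b : Fin n, ∑ X' ∈ (univ.filter fun X' : Fin m → Fin n × Γ => (X' i).2 = w).filter (fun X' => (X' i).1 = b), ‖kernel 𝕜 F m X'‖ :=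
        (sum_fiberwise _ (fun X' : Fin m → Fin n × Γ => (X' i).1) _).symm
    _ = ∑ b : Fin n, ∑ X' ∈ univ.filter (fun X' : Fin m → Fin n × Γ => X' i = (b, w)), ‖kernel 𝕜 F m X'‖ := by
        refine sum_congr rfl fun b _ => sum_congr ?_ fun _ _ => rfl
        ext X'
        simp only [mem_filter, mem_univ, true_and, Prod.ext_iff]
        tauto

end KernelCollapseNorm

/-! ### Multilinearity of the truncated expectation in the vertices -/

section Multilinear

variable (R : Type*) [CommRing R] [Algebra ℚ R] {Γ : Type*} [Fintype Γ] [DecidableEq Γ] {ι : Type*} [Fintype ι] [DecidableEq ι]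
variable (C : Matrix Γ Γ R) (cl : Γ → ι)

/-- **The truncated expectation of sums of cluster-supported vertices is the sum over the choices**
(multilinearity, here read off the tree formula). [folklore] -/
theorem ursellOf_convMoment_eq_sum_piFinset {κ : Type*} (D : ι → Finset κ) (M' : ι → κ → evenPart R Γ)
    (hM' : ∀ v d, (M' v d : GrassmannAlgebra R Γ) ∈ fieldSubalgebra R (cl ⁻¹' {v})) (v₀ : ι) :
    ursellOf (convMoment R C fun v => ∑ d ∈ D v, M' v d) univ =
      ∑ δ ∈ Fintype.piFinset D, ursellOf (convMoment R C fun v => M' v (δ v)) univ := by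
  have hM : ∀ v, ((∑ d ∈ D v, M' v d : evenPart R Γ) : GrassmannAlgebra R Γ) ∈ fieldSubalgebra R (cl ⁻¹' {v}) := fun v => by
    rw [AddSubmonoidClass.coe_finsetSum]
    exact Subalgebra.sum_mem _ fun d _ => hM' v d
  rw [ursellOf_convMoment_eq_treeOp R C cl hM univ (mem_univ v₀), prod_univ_sum, map_sum]
  exact sum_congr rfl fun δ _ => (ursellOf_convMoment_eq_treeOp R C cl (fun v => hM' v (δ v)) univ (mem_univ v₀)).symm

end Multilinear

/-! ### One even element and its replicas -/

section Vertex

variable (R : Type*) [CommRing R] {Γ : Type*} [Fintype Γ] [DecidableEq Γ] {n : ℕ}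

/-- An even element presented by kernels of the even degrees `2m'`, `m' ∈ degs`:
`V = Σ_{m'} Σ_Y K_{m'}(Y) ψ(Y_0)⋯ψ(Y_{2m'-1})`. [folklore] -/
def vertexOf (degs : Finset ℕ) (K : (m' : ℕ) → (Fin (2 * m') → Γ) → R) : evenPart R Γ :=
  ∑ m' ∈ degs, ∑ Y : Fin (2 * m') → Γ, K m' Y • evenGenProd (even_two_mul m') Y

/-- Its replica in the copy `a` of `Fin n × Γ`. [folklore] -/
def replicaVertex (degs : Finset ℕ) (K : (m' : ℕ) → (Fin (2 * m') → Γ) → R) (a : Fin n) : evenPart R (Fin n × Γ) :=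
  ∑ m' ∈ degs, kernelVertex R (deg := fun _ : Fin n => 2 * m') (fun _ => even_two_mul m') (fun b => replicaKer R (K m') b) a

/-- Unfolding `replicaVertex` in one degree. [folklore] -/
theorem kernelVertex_replicaKer_eq (m' : ℕ) (K : (Fin (2 * m') → Γ) → R) (a : Fin n) :
    kernelVertex R (deg := fun _ : Fin n => 2 * m') (fun _ => even_two_mul m') (fun b => replicaKer R K b) a =
      ∑ Y' : Fin (2 * m') → Fin n × Γ, replicaKer R K a Y' • evenGenProd (even_two_mul m') Y' := rfl

/-- **The replicas collapse to the element.** [folklore] -/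
theorem collapseEven_replicaVertex (degs : Finset ℕ) (K : (m' : ℕ) → (Fin (2 * m') → Γ) → R) (a : Fin n) :
    collapseEven R (Prod.snd : Fin n × Γ → Γ) (replicaVertex R degs K a) = vertexOf R degs K := by
  refine Subtype.ext ?_
  rw [coe_collapseEven, replicaVertex, vertexOf, AddSubmonoidClass.coe_finsetSum, AddSubmonoidClass.coe_finsetSum, map_sum]
  refine sum_congr rfl fun m' _ => ?_
  rw [kernelVertex_replicaKer_eq, AddSubmonoidClass.coe_finsetSum, AddSubmonoidClass.coe_finsetSum]
  simp only [Subalgebra.coe_smul, coe_evenGenProd]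
  exact collapse_sum_replicaKer_smul_genProd R (K m') a

/-- The replica of copy `a` is supported in copy `a`. [folklore] -/
theorem coe_kernelVertex_replicaKer_mem (m' : ℕ) (K : (Fin (2 * m') → Γ) → R) (a : Fin n) :
    (kernelVertex R (deg := fun _ : Fin n => 2 * m') (fun _ => even_two_mul m') (fun b => replicaKer R K b) a : GrassmannAlgebra R (Fin n × Γ)) ∈
      fieldSubalgebra R ((Prod.fst : Fin n × Γ → Fin n) ⁻¹' {a}) :=
  coe_kernelVertex_mem R Prod.fst _ _ (fun b Yv h j => replicaKer_support R K b Yv h j) a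

end Vertex

/-! ### Too few fields: the kernels vanish -/

section Vanishing

variable {𝕜 : Type*} [RCLike 𝕜] {Γ : Type*} [Fintype Γ] [DecidableEq Γ]

omit [RCLike 𝕜] [Fintype Γ] [DecidableEq Γ] in
/-- A step needs as many positions as it deletes. [folklore] -/
theorem DelOp.cost_le_card_of_mem_stepSet {N : ℕ} (S : Finset (Fin N)) : ∀ (o : DelOp Γ 𝕜) {pq : Fin N × Fin N},
    pq ∈ DelOp.stepSet S o → o.cost ≤ S.card
  | DelOp.ext _, pq, h => by
    rw [DelOp.stepSet, mem_filter, mem_product] at h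
    exact card_pos.2 ⟨pq.1, h.1.1⟩
  | DelOp.lap _, pq, h => by
    rw [DelOp.stepSet, mem_filter, mem_product] at h
    rw [DelOp.cost]
    have h2 : ({pq.1, pq.2} : Finset (Fin N)) ⊆ S := by
      intro x hx
      rcases mem_insert.1 hx with rfl | hx
      · exact h.1.1
      · rw [mem_singleton.1 hx]; exact h.1.2
    have := card_le_card h2
    rwa [card_pair (Ne.symm h.2)] at this

omit [RCLike 𝕜] [Fintype Γ] [DecidableEq Γ] in
/-- There is no deletion pattern deleting more fields than there are. [folklore] -/
theorem patSet_eq_empty_of_card_lt {N : ℕ} : ∀ (ops : List (DelOp Γ 𝕜)) (S : Finset (Fin N)), S.card < totalCost ops → patSet ops S = ∅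
  | [], S, h => absurd h (by simp [totalCost])
  | o :: ops, S, h => by
    rw [patSet, map_eq_empty, sigma_eq_empty]
    intro pq hpq
    refine patSet_eq_empty_of_card_lt ops _ ?_
    rw [DelOp.card_rest o hpq]
    have hc : totalCost (o :: ops) = o.cost + totalCost ops := by rw [totalCost, totalCost, List.map_cons, List.sum_cons]
    have hle := DelOp.cost_le_card_of_mem_stepSet S o hpq
    omega

variable {n : ℕ} (C : Matrix Γ Γ 𝕜) (cl : Γ → Fin n) {deg : Fin n → ℕ} (K : ∀ v : Fin n, (Fin (deg v) → Γ) → 𝕜)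

/-- **With fewer than `r + 2(n-1)` fields the `r`-kernels of the truncated expectation of `n` kernel vertices
vanish** (every tree has `n - 1` lines deleting two fields each). [folklore] -/
theorem kernel_ursellOf_kernelVertex_eq_zero_of_lt {E : Type*} [NormedAddCommGroup E] [InnerProductSpace 𝕜 E]
    (q : Γ → Bool) (hC : ∀ X Y, q X = q Y → C X Y = 0) (f g : Γ → E) {κ : ℝ} (hκ : 0 ≤ κ)
    (hf : ∀ X, q X = true → ‖f X‖ ≤ κ) (hg : ∀ Y, q Y = false → ‖g Y‖ ≤ κ)
    (hG : ∀ X Y, q X = true → q Y = false → contr 𝕜 C X Y = ⟪f X, g Y⟫_𝕜)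
    (hm : ∀ v, Even (deg v)) (hK : ∀ v Yv, K v Yv ≠ 0 → ∀ j, cl (Yv j) = v) (v₀ : Fin n) {r : ℕ}
    (hlt : (∑ v, deg v) < r + 2 * (n - 1)) (W : Fin r → Γ) :
    kernel 𝕜 ((ursellOf (convMoment 𝕜 C (kernelVertex 𝕜 hm K)) univ : evenPart 𝕜 Γ) : GrassmannAlgebra 𝕜 Γ) r W = 0 := by
  refine norm_le_zero_iff.1 ((norm_kernel_ursellOf_kernelVertex_le C cl K hm hK v₀ r W).trans (le_of_eq ?_))
  refine sum_eq_zero fun Ys _ => ?_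
  rw [sum_eq_zero fun k _ => ?_, mul_zero]
  refine sum_eq_zero fun s _ => ?_
  split_ifs with h
  · have hk : k = n - 1 := by
      have h' := Script.card_image_y s h.1
      rw [h.2, card_univ, Fintype.card_fin] at h'
      omega
    have hb := norm_kernel_treeFactor_genProd_le C cl q hC f g hκ hf hg hG s h.1 (flat Ys) W
    rw [patSet_eq_empty_of_card_lt _ _ (by rw [card_univ, Fintype.card_fin, totalCost_scriptOps]; omega), sum_empty,
      mul_zero, zero_mul] at hb
    exact le_antisymm hb (norm_nonneg _)
  · rfl

end Vanishing

/-! ### The bound -/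

section Main

variable {𝕜 : Type*} [RCLike 𝕜] {Γ : Type*} [Fintype Γ] [DecidableEq Γ] {n : ℕ} (C : Matrix Γ Γ 𝕜)

/-- The bound for one degree assignment `δ` (degrees `2δ_a`) of the `n` copies: `(r!)⁻¹ N_δ^{(r)} κ^{N_δ-r-2(n-1)}
(∏_a N(δ_a)) · λ^{-(n-1)} ∏_ℓ (1 + λ α (2δ)(2δ')_ℓ)`, `N_δ = Σ_a 2δ_a`. [folklore] -/
def cumulantBound (n : ℕ) (κ α lam : ℝ) (N : ℕ → ℝ) (r : ℕ) (δ : Fin n → ℕ) : ℝ :=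
  ((((r.factorial : ℝ))⁻¹ * ((∑ a, 2 * δ a).descFactorial r : ℝ)) * κ ^ ((∑ a, 2 * δ a) - (r + 2 * (n - 1))) * ∏ a, N (δ a)) *
    ((lam⁻¹) ^ (n - 1) * ∏ ℓ : Sym2 (Fin n), (1 + lam * (α * (pairDeg (fun a => 2 * δ a) ℓ : ℝ))))

/-- **The `L¹–L^∞` bound for the kernels of `𝓔ᵀ_C(V; n)`** (Benfatto–Giuliani–Mastropietro 2006, (2.13)–(2.14)
with (2.77)–(2.80); Gawȩdzki–Kupiainen 1985): for `V = Σ_{m' ∈ degs} Σ_Y K_{m'}(Y) ψ(Y)` with anchored `L¹`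
norms `≤ N(m')`, a charged covariance in Gram form on the mixed pairs with constant `κ` and one-copy row and
column sums of `‖C‖` at most `α`, and any positive `λ_δ` (it may depend on the degree assignment; the choice
`λ_δ = 1/(α (N_δ + n))` makes `λ_δ^{-(n-1)} ∏_ℓ (1 + λ_δ α (2δ)(2δ')_ℓ) ≤ (n-1)! (eα)^{n-1} e ∏_a e^{3δ_a}`): one output
label pinned and the others summed, `Σ_{W : W_i = w} ‖kernel_r 𝓔ᵀ_C(V; n) (W)‖ ≤ n · Σ_δ cumulantBound(δ)` (the
factor `n`: the copy of the pinned label) — no `n!` beyond the `(n-1)!` cancelled by the `1/n!` of the cumulant series.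
[cite: BenfattoGiulianiMastropietro2006, (2.13)-(2.14) and (2.77)-(2.80)] -/
theorem sum_norm_kernel_cumulantOf_le {E : Type*} [NormedAddCommGroup E] [InnerProductSpace 𝕜 E]
    (q : Γ → Bool) (hC : ∀ X Y, q X = q Y → C X Y = 0) (f g : Γ → E) {κ : ℝ} (hκ : 0 ≤ κ)
    (hf : ∀ X, q X = true → ‖f X‖ ≤ κ) (hg : ∀ Y, q Y = false → ‖g Y‖ ≤ κ)
    (hG : ∀ X Y, q X = true → q Y = false → contr 𝕜 C X Y = ⟪f X, g Y⟫_𝕜)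
    (degs : Finset ℕ) (K : (m' : ℕ) → (Fin (2 * m') → Γ) → 𝕜) (N : ℕ → ℝ) (hN0 : ∀ m', 0 ≤ N m')
    (hN : ∀ m' (j : Fin (2 * m')) (w : Γ), ∑ Y ∈ univ.filter (fun Y : Fin (2 * m') → Γ => Y j = w), ‖K m' Y‖ ≤ N m')
    {α : ℝ} (hα : 0 ≤ α) (hrow : ∀ X, ∑ Y, ‖C X Y‖ ≤ α) (hcol : ∀ Y, ∑ X, ‖C X Y‖ ≤ α)
    (lam : (Fin n → ℕ) → ℝ) (hlam : ∀ δ, 0 < lam δ) (hn : 0 < n) {r : ℕ} (i : Fin r) (w : Γ) :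
    ∑ W ∈ univ.filter (fun W : Fin r → Γ => W i = w),
        ‖kernel 𝕜 ((cumulantOf (fun k => evenGaussConv 𝕜 C (vertexOf 𝕜 degs K ^ k)) n : evenPart 𝕜 Γ) : GrassmannAlgebra 𝕜 Γ) r W‖ ≤
      (n : ℝ) * ∑ δ ∈ Fintype.piFinset (fun _ : Fin n => degs),
        (if r + 2 * (n - 1) ≤ ∑ a, 2 * δ a then cumulantBound n κ α (lam δ) N r δ else 0) := by
  set C' : Matrix (Fin n × Γ) (Fin n × Γ) 𝕜 := C.submatrix Prod.snd Prod.snd with hC'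
  have huniv : (univ : Finset (Fin n)).Nonempty := ⟨⟨0, hn⟩, mem_univ _⟩
  -- the degree-`δ` replica families
  set U : (Fin n → ℕ) → evenPart 𝕜 (Fin n × Γ) := fun δ => ursellOf (convMoment 𝕜 C'
    (kernelVertex 𝕜 (deg := fun b : Fin n => 2 * δ b) (fun b => even_two_mul (δ b)) fun b => replicaKer 𝕜 (K (δ b)) b)) univ with hU
  -- replicas, collapse and multilinearity
  have hcum : ((cumulantOf (fun k => evenGaussConv 𝕜 C (vertexOf 𝕜 degs K ^ k)) n : evenPart 𝕜 Γ) : GrassmannAlgebra 𝕜 Γ) =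
      ∑ δ ∈ Fintype.piFinset (fun _ : Fin n => degs), collapse 𝕜 (Prod.snd : Fin n × Γ → Γ) (U δ : GrassmannAlgebra 𝕜 (Fin n × Γ)) := by
    have h1 := collapseEven_ursellOf_convMoment_eq_cumulantOf 𝕜 (Prod.snd : Fin n × Γ → Γ) C (replicaVertex 𝕜 degs K)
      (vertexOf 𝕜 degs K) (collapseEven_replicaVertex 𝕜 degs K) huniv
    rw [card_univ, Fintype.card_fin] at h1
    rw [← h1, coe_collapseEven]
    have h2 : ursellOf (convMoment 𝕜 C' (replicaVertex 𝕜 degs K)) univ = ∑ δ ∈ Fintype.piFinset (fun _ : Fin n => degs), U δ := by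
      have h := ursellOf_convMoment_eq_sum_piFinset 𝕜 C' (Prod.fst : Fin n × Γ → Fin n) (fun _ : Fin n => degs)
        (fun a m' => kernelVertex 𝕜 (deg := fun _ : Fin n => 2 * m') (fun _ => even_two_mul m') (fun b => replicaKer 𝕜 (K m') b) a)
        (fun a m' => coe_kernelVertex_replicaKer_mem 𝕜 m' (K m') a) ⟨0, hn⟩
      exact h
    rw [← hC', h2, AddSubmonoidClass.coe_finsetSum, map_sum]
  -- the bound per degree assignment and pinned copy
  have hδ : ∀ (δ : Fin n → ℕ) (b : Fin n), ∑ W' ∈ univ.filter (fun W' : Fin r → Fin n × Γ => W' i = (b, w)),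
      ‖kernel 𝕜 (U δ : GrassmannAlgebra 𝕜 (Fin n × Γ)) r W'‖ ≤ if r + 2 * (n - 1) ≤ ∑ a, 2 * δ a then cumulantBound n κ α (lam δ) N r δ else 0 := by
    intro δ b
    have hC'' : ∀ X' Y' : Fin n × Γ, q X'.2 = q Y'.2 → C' X' Y' = 0 := fun X' Y' h => hC _ _ h
    have hG' : ∀ X' Y' : Fin n × Γ, q X'.2 = true → q Y'.2 = false → contr 𝕜 C' X' Y' = ⟪f X'.2, g Y'.2⟫_𝕜 :=
      fun X' Y' h1 h2 => by rw [hC', contr_submatrix]; exact hG _ _ h1 h2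
    have hKs : ∀ (v : Fin n) (Yv : Fin (2 * δ v) → Fin n × Γ), replicaKer 𝕜 (K (δ v)) v Yv ≠ 0 → ∀ j, (Yv j).1 = v :=
      fun v Yv h j => replicaKer_support 𝕜 (K (δ v)) v Yv h j
    split_ifs with hle
    · exact sum_norm_kernel_ursellOf_kernelVertex_le C' (Prod.fst : Fin n × Γ → Fin n) (fun b => replicaKer 𝕜 (K (δ b)) b)
        (fun X' => q X'.2) hC'' (fun X' => f X'.2) (fun Y' => g Y'.2) hκ (fun X' h => hf _ h) (fun Y' h => hg _ h) hG'
        (fun b => even_two_mul (δ b)) hKs (fun u => N (δ u)) (fun u => hN0 _)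
        (fun u j a' => sum_filter_norm_replicaKer_le (K (δ u)) u (hN (δ u)) j a') hα
        (fun ℓ X' => sum_norm_typeRestrict_submatrix_le C hα hrow ℓ X') (fun ℓ Y' => sum_norm_typeRestrict_submatrix_le' C hα hcol ℓ Y')
        (hlam δ) i (b, w)
    · refine le_of_eq (sum_eq_zero fun W' _ => ?_)
      rw [hU]
      dsimp only
      rw [kernel_ursellOf_kernelVertex_eq_zero_of_lt C' (Prod.fst : Fin n × Γ → Fin n) (fun b => replicaKer 𝕜 (K (δ b)) b)
        (fun X' => q X'.2) hC'' (fun X' => f X'.2) (fun Y' => g Y'.2) hκ (fun X' h => hf _ h) (fun Y' h => hg _ h) hG'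
        (fun b => even_two_mul (δ b)) hKs ⟨0, hn⟩ (not_le.1 hle) W', norm_zero]
  -- assemble
  calc ∑ W ∈ univ.filter (fun W : Fin r → Γ => W i = w),
          ‖kernel 𝕜 ((cumulantOf (fun k => evenGaussConv 𝕜 C (vertexOf 𝕜 degs K ^ k)) n : evenPart 𝕜 Γ) : GrassmannAlgebra 𝕜 Γ) r W‖
      ≤ ∑ W ∈ univ.filter (fun W : Fin r → Γ => W i = w), ∑ δ ∈ Fintype.piFinset (fun _ : Fin n => degs),
          ‖kernel 𝕜 (collapse 𝕜 (Prod.snd : Fin n × Γ → Γ) (U δ : GrassmannAlgebra 𝕜 (Fin n × Γ))) r W‖ := by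
        refine sum_le_sum fun W _ => ?_
        rw [hcum, kernel_sum]
        exact norm_sum_le _ _
    _ = ∑ δ ∈ Fintype.piFinset (fun _ : Fin n => degs), ∑ W ∈ univ.filter (fun W : Fin r → Γ => W i = w),
          ‖kernel 𝕜 (collapse 𝕜 (Prod.snd : Fin n × Γ → Γ) (U δ : GrassmannAlgebra 𝕜 (Fin n × Γ))) r W‖ := sum_comm
    _ ≤ ∑ δ ∈ Fintype.piFinset (fun _ : Fin n => degs), ∑ _b : Fin n,
          (if r + 2 * (n - 1) ≤ ∑ a, 2 * δ a then cumulantBound n κ α (lam δ) N r δ else 0) :=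
        sum_le_sum fun δ _ => (sum_filter_norm_kernel_collapse_le _ i w).trans (sum_le_sum fun b _ => hδ δ b)
    _ = (n : ℝ) * ∑ δ ∈ Fintype.piFinset (fun _ : Fin n => degs),
          (if r + 2 * (n - 1) ≤ ∑ a, 2 * δ a then cumulantBound n κ α (lam δ) N r δ else 0) := by
        rw [mul_sum]
        exact sum_congr rfl fun δ _ => by rw [sum_const, card_univ, Fintype.card_fin, nsmul_eq_mul]

end Main

end Literature.MathematicalPhysics.QuantumLattice
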